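import Literature.AlgebraicGeometry.Resolution.CharPolyhedronSolvableVertex
import Literature.AlgebraicGeometry.Resolution.CharPolyhedronOriginChart
import Mathlib.Algebra.BigOperators.Fin
import HarnessLib

/-!
# [OURS · L1 W4.2] D18 — WEIGHTED MINIMAL EXPONENTS: digit weights, and «`f ≡ κ·u^e` modulo higher weight pins `e ∈ 𝐒(f)` with class `κ̄`»
# (cell res-hironaka, LADDER-RESOLUTION rung L; slot W4.2, crux chain w42 `SigmaMaxModificationsCorridor3` stmt-ResolutionOfSingularities-19249;
# `--supports stmt-ResolutionOfSingularities-19249 --as helper`; hand res-D-brk-3 (gen 7), file F1d-a, the two tools of the any-codimension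
# face vertex `…CPFrameFaceVertexAny`)

PURE COMMUTATIVE ALGEBRA, 0 `def`s, every declaration PROVED; OURS bookkeeping; NOT a statement of Hironaka's manuscript [Hironaka2017] nor of
[CossartPiltant2019]/[CossartJannsenSaito2020]. AI-written, weaker than expert review.

* `sum_mul_pow_injective_of_lt` — base-`M` digits are unique (the weight vector `(M^k)_k` separates a finite set of exponents).
* `mem_minExponents_of_sub_mem_monomialIdeal` — for `u` part of an r.s.p., an INTEGER-valued positive weight `β` and `f ≡ κ·u^e (mod I_β(|e|_β + 1))`
  with `κ` a unit: `e ∈ 𝐒(f)`, every other minimal exponent of `f` has weight `≥ |e|_β + 1`, and `γ̄(f, e) = κ̄` (CP 2019 Prop. 2.1 with the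
  saturation (2.5) of monomial ideals, tree `IsRsopPart.mem_of_mul_mem_span_uPow`).

References: CP 2019 = arXiv:1412.0868v1, Prop. 2.1, (2.5), Def. 2.2 (pp. 9–11) [CossartPiltant2019].
-/

noncomputable section

set_option linter.dupNamespace false

open IsLocalRing Polynomial Finset
open Literature.AlgebraicGeometry.Resolution Literature.AlgebraicGeometry.Resolution.CossartPiltant

universe u

namespace Summit.ResolutionOfSingularities.ResolutionOfSingularities.Theorems.SigmaMaxModificationsCorridor3.Helpers

/-! ## §1. Digit weights -/

/-- Base-`M` digits are unique: `a ↦ Σ_i a_i M^i` is injective on vectors with entries `< M`. [folklore] -/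
theorem sum_mul_pow_injective_of_lt {k M : ℕ} {a b : Fin k → ℕ} (ha : ∀ i, a i < M) (hb : ∀ i, b i < M)
    (h : ∑ i, a i * M ^ (i : ℕ) = ∑ i, b i * M ^ (i : ℕ)) : a = b := by
  induction k with
  | zero => funext i; exact i.elim0
  | succ k ih =>
    rw [Fin.sum_univ_succ, Fin.sum_univ_succ] at h
    simp only [Fin.val_zero, pow_zero, mul_one, Fin.val_succ, pow_succ] at h
    have hsplit : ∀ (c : Fin (k + 1) → ℕ), ∑ i : Fin k, c i.succ * (M ^ (i : ℕ) * M) = M * ∑ i : Fin k, c i.succ * M ^ (i : ℕ) := by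
      intro c
      rw [Finset.mul_sum]
      exact Finset.sum_congr rfl fun i _ => by ring
    rw [hsplit a, hsplit b] at h
    have hM : 0 < M := by have := ha 0; omega
    have h0 : a 0 = b 0 := by
      have := congrArg (· % M) h
      simp only [Nat.add_mul_mod_self_left, Nat.mod_eq_of_lt (ha 0), Nat.mod_eq_of_lt (hb 0)] at this
      exact this
    have hrest : (fun i : Fin k => a i.succ) = fun i => b i.succ := by
      apply ih (fun i => ha i.succ) (fun i => hb i.succ)
      have h1 : M * ∑ i : Fin k, a i.succ * M ^ (i : ℕ) = M * ∑ i : Fin k, b i.succ * M ^ (i : ℕ) := by omega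
      exact Nat.eq_of_mul_eq_mul_left hM h1
    funext i
    refine Fin.cases h0 (fun i => ?_) i
    exact congrFun hrest i

/-! ## §2. A monomial-plus-higher-weight congruence pins a minimal exponent and its coefficient class -/

section Weighted

variable {R : Type u} [CommRing R] [IsLocalRing R] {n : ℕ} {u : Fin n → R}

/-- For `u` part of an r.s.p., an INTEGER-valued positive weight `β` and `f ≡ κ·u^e (mod I_β(|e|_β + 1))` with `κ` a unit: `e ∈ 𝐒(f)`, every other
minimal exponent has weight `≥ |e|_β + 1`, and `γ̄(f, e) = κ̄`. [cite: CossartPiltant2019, Prop. 2.1 (arXiv v1 p. 10)] -/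
theorem mem_minExponents_of_sub_mem_monomialIdeal (hz : IsRsopPart u) {β : Fin n → ℝ} (hβ : ∀ j, 0 < β j)
    (wt : (Fin n → ℕ) → ℕ) (hwt : ∀ a, weight β a = (wt a : ℝ)) {f κ : R} (hκ : IsUnit κ) (e : Fin n → ℕ)
    (hf : f - κ * uPow u e ∈ monomialIdeal u β ((wt e : ℝ) + 1)) :
    e ∈ minExponents u f ∧ (∀ a ∈ minExponents u f, a ≠ e → ((wt e : ℝ) + 1) ≤ weight β a) ∧
      coeffClass u f e = Ideal.Quotient.mk _ κ := by
  classical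
  haveI := hz.isRegularLocalRing
  have hβ0 : ∀ j, 0 ≤ β j := fun j => (hβ j).le
  obtain ⟨hanti, hmem, href⟩ := hz.minExponents_spec f
  -- no `g·u^e` with `g ∉ (u)` lies in `I_β(|e| + 1)` (monomial ideals are saturated, CP (2.5))
  have hnot : ∀ {g : R}, g ∉ Ideal.span (Set.range u) → g * uPow u e ∉ monomialIdeal u β ((wt e : ℝ) + 1) := by
    intro g hg hmemg
    have h1 : uPow u e ∈ monomialIdeal u β ((wt e : ℝ) + 1) := by
      rw [monomialIdeal_eq_span_image] at hmemg ⊢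
      exact hz.mem_of_mul_mem_span_uPow hg _ hmemg
    rw [uPow_mem_monomialIdeal_iff u hz.mem_span_image_of_mul_mem hz.span_range_ne_top hβ0, hwt] at h1
    linarith
  have hκu : κ ∉ Ideal.span (Set.range u) := fun hmemκ =>
    (IsLocalRing.mem_maximalIdeal _).mp (hz.span_range_le_maximalIdeal hmemκ) hκ
  -- the refinement
  have hshape : ∀ a ∈ minExponents u f, e ≤ a ∨ ((wt e : ℝ) + 1) ≤ weight β a := by
    intro a ha
    have hB : f ∈ Ideal.span (uPow u '' ({e} ∪ {b | ((wt e : ℝ) + 1) ≤ weight β b})) := by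
      have h1 : κ * uPow u e ∈ Ideal.span (uPow u '' ({e} ∪ {b | ((wt e : ℝ) + 1) ≤ weight β b})) :=
        Ideal.mul_mem_left _ _ (Ideal.subset_span ⟨e, Or.inl rfl, rfl⟩)
      have h2 : f - κ * uPow u e ∈ Ideal.span (uPow u '' ({e} ∪ {b | ((wt e : ℝ) + 1) ≤ weight β b})) := by
        refine (Ideal.span_mono ?_) (by rw [monomialIdeal_eq_span_image] at hf; exact hf)
        exact Set.image_mono Set.subset_union_right
      have := Ideal.add_mem _ h2 h1
      rwa [sub_add_cancel] at this
    obtain ⟨b, hb, hle⟩ := href _ hB a ha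
    rcases hb with hb | hb
    · rw [Set.mem_singleton_iff] at hb; subst hb; exact Or.inl hle
    · exact Or.inr (le_trans hb (weight_mono hβ0 hle))
  have hstrict : ∀ a ∈ minExponents u f, a ≠ e → ((wt e : ℝ) + 1) ≤ weight β a := by
    intro a ha hne
    rcases hshape a ha with hle | hw
    · have hlt := weight_lt_of_le_of_ne hβ hle (Ne.symm hne)
      rw [hwt, hwt] at hlt
      rw [hwt]
      have hlt' : wt e < wt a := by exact_mod_cast hlt
      exact_mod_cast (show wt e + 1 ≤ wt a by omega)
    · exact hw
  -- (a) `e ∈ 𝐒(f)`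
  have hemem : e ∈ minExponents u f := by
    by_contra hne
    have hall : ∀ a ∈ minExponents u f, ((wt e : ℝ) + 1) ≤ weight β a := fun a ha => hstrict a ha (fun h => hne (h ▸ ha))
    have hfJ : f ∈ monomialIdeal u β ((wt e : ℝ) + 1) := (mem_monomialIdeal_iff_of_minimal u hβ0 hmem href).mpr hall
    have : κ * uPow u e ∈ monomialIdeal u β ((wt e : ℝ) + 1) := by
      have := Ideal.sub_mem _ hfJ hf
      rwa [sub_sub_cancel] at this
    exact hnot hκu this
  refine ⟨hemem, hstrict, ?_⟩
  -- (c) the coefficient class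
  obtain ⟨γ, hγ⟩ := exists_expansion_minExponents u hmem
  rw [coeffClass_eq_mk u hz.mem_span_image_of_mul_mem hanti hγ hemem, Ideal.Quotient.eq]
  by_contra hγκ
  have hrest : ∑ b ∈ (minExponents u f).erase e, γ b * uPow u b ∈ monomialIdeal u β ((wt e : ℝ) + 1) := by
    refine Ideal.sum_mem _ fun b hb => ?_
    obtain ⟨hbne, hbmem⟩ := Finset.mem_erase.mp hb
    exact Ideal.mul_mem_left _ _ (uPow_mem_monomialIdeal u (hstrict b hbmem hbne))
  have hfγ : f - γ e * uPow u e ∈ monomialIdeal u β ((wt e : ℝ) + 1) := by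
    have h1 : f = γ e * uPow u e + ∑ b ∈ (minExponents u f).erase e, γ b * uPow u b :=
      calc f = ∑ b ∈ minExponents u f, γ b * uPow u b := hγ
        _ = _ := (Finset.add_sum_erase _ _ hemem).symm
    rw [h1, add_sub_cancel_left]
    exact hrest
  have : (γ e - κ) * uPow u e ∈ monomialIdeal u β ((wt e : ℝ) + 1) := by
    have := Ideal.sub_mem _ hf hfγ
    rw [show f - κ * uPow u e - (f - γ e * uPow u e) = (γ e - κ) * uPow u e by ring] at this
    exact this
  exact hnot hγκ this

end Weighted

end Summit.ResolutionOfSingularities.ResolutionOfSingularities.Theorems.SigmaMaxModificationsCorridor3.Helpers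

end
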